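import Mathlib.Analysis.SpecialFunctions.Pow.Continuity
import Mathlib.Order.Filter.Finite
import Literature.NumberTheory.LFunctions.ColossallyAbundantProofs
import Literature.NumberTheory.LFunctions.ColossallyAbundant55440
import Literature.NumberTheory.LFunctions.RobinCriterion
import HarnessLib

/-!
# Structure of the colossally abundant numbers: consecutive ones share a parameter

Topic: `Literature/NumberTheory/LFunctions`. Discharges the named fact
`Nat.colossallyAbundant_consecutive_common_parameter` of `RobinCriterion.lean` (Robin 1984,
p. 190; Briggs 2006, Thm. 2.1; Caveney–Nicolas–Sondow 2012, §2), the structural input of Robin's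
§3 Prop. 1 in the DAG of `Literature.NumberTheory.LFunctions.robin_iff` (provefact): if `N < N'` are colossally abundant and no
colossally abundant number lies strictly between them, some `ε > 0` is a parameter of both.
Consequently `Literature.NumberTheory.LFunctions.Robin1984_prop1` holds outright (`Literature.NumberTheory.LFunctions.Robin1984_prop1_holds`).

## Proof (the convexity picture of Alaoglu–Erdős / Erdős–Nicolas / Robin p. 190, elementarily)

Write `F_ε(m) = σ(m)/m^{1+ε}` (`Nat.sigmaRpow ε m`) and let `T(N) = {ε > 0 : ε is a parameter of N}`.
* `F_{ε'}(m) = F_ε(m) / m^{ε'−ε}`; hence (i) if `m ≤ N`, `F_α(m) ≤ F_α(N)` and `ε ≤ α` then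
  `F_ε(m) ≤ F_ε(N)` (smaller competitors only lose when `ε` decreases), and (ii) if `ε` is a
  parameter of `m`, `ε'` one of `m'` and `m < m'`, then `ε' ≤ ε` (`Nat.IsCAParameter.antitone`).
* `T(N) ⊂ [log(1 + 1/q)/log q, ∞)` for a prime `q ∤ N` (compare `N` with `N q`), and `T(N)` is
  closed under infima (continuity of `ε ↦ F_ε(m)`), so `α = inf T(N) ∈ T(N)`, `α > 0`.
* At `α` some `m⋆ > N` is a co-maximiser: otherwise `F_α(m) < F_α(N)` for all `m > N`; the
  finitely many `m ∈ (N, M₁]` keep the strict inequality for `ε` near `α` (continuity), the `m > M₁`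
  have `F_ε(m) < 1 ≤ F_ε(N)` uniformly for `ε ≥ α/2` (decay), and the `m ≤ N` are handled by (i);
  so some `ε < α` lies in `T(N)`, contradicting `α = inf T(N)`.
* `m⋆` is colossally abundant with parameter `α`, hence `N' ≤ m⋆`; if `N' < m⋆`, (ii) applied to
  `(N, α), (N', ε')` and to `(N', ε'), (m⋆, α)` squeezes any parameter `ε'` of `N'` to `α`.

## Sources

* G. Robin, J. Math. Pures Appl. 63 (1984), p. 190 (structure of CA numbers). [Robin1984]
* K. Briggs, Exp. Math. 15 (2006), Thm. 2.1. [Briggs2006]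
* G. Caveney, J.-L. Nicolas, J. Sondow, Ramanujan J. 29 (2012), §2. [CaveneyNicolasSondow2012]
* L. Alaoglu, P. Erdős, Trans. AMS 56 (1944), §3. [AlaogluErdos1944]
-/

noncomputable section

open Real Finset Filter
open scoped ArithmeticFunction.sigma Topology

namespace Nat

/-! ### `F_ε(m) = σ(m)/m^{1+ε}` -/

/-- `Nat.sigmaRpow ε m = σ(m)/m^{1+ε}`, the function maximised by a colossally abundant number of
parameter `ε` (Alaoglu–Erdős 1944, §3; Caveney–Nicolas–Sondow 2012, §2). By `Iff.rfl`,
`Nat.IsCAParameter ε n ↔ ∀ m ≥ 1, sigmaRpow ε m ≤ sigmaRpow ε n`.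
[cite: CaveneyNicolasSondow2012, §2] -/
def sigmaRpow (ε : ℝ) (m : ℕ) : ℝ :=
  (σ 1 m : ℝ) / (m : ℝ) ^ (1 + ε)

/-- Unfolding of `IsCAParameter` through `sigmaRpow`. [cite: CaveneyNicolasSondow2012, §2] -/
theorem isCAParameter_iff_sigmaRpow {ε : ℝ} {n : ℕ} :
    IsCAParameter ε n ↔ ∀ m : ℕ, 1 ≤ m → sigmaRpow ε m ≤ sigmaRpow ε n :=
  Iff.rfl

/-- `F_ε(1) = 1`. [folklore] -/
@[simp] theorem sigmaRpow_one (ε : ℝ) : sigmaRpow ε 1 = 1 := by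
  simp [sigmaRpow]

/-- `1 ≤ σ(m)` for `m ≥ 1`. [folklore] -/
theorem one_le_sigma_one {m : ℕ} (hm : m ≠ 0) : 1 ≤ σ 1 m := by
  rw [ArithmeticFunction.sigma_one_apply]
  exact Finset.single_le_sum (fun d _ => Nat.zero_le d) (Nat.one_mem_divisors.2 hm)

/-- `F_ε(m) > 0` for `m ≥ 1`. [folklore] -/
theorem sigmaRpow_pos (ε : ℝ) {m : ℕ} (hm : 1 ≤ m) : 0 < sigmaRpow ε m := by
  unfold sigmaRpow
  have h1 : (1 : ℝ) ≤ σ 1 m := by exact_mod_cast one_le_sigma_one (by omega)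
  have h2 : (0 : ℝ) < m := by exact_mod_cast hm
  positivity

/-- Change of parameter: `F_{ε'}(m) = F_ε(m) / m^{ε'−ε}`. [folklore] -/
theorem sigmaRpow_eq_div (ε ε' : ℝ) {m : ℕ} (hm : 1 ≤ m) :
    sigmaRpow ε' m = sigmaRpow ε m / (m : ℝ) ^ (ε' - ε) := by
  unfold sigmaRpow
  have h : (0 : ℝ) < m := by exact_mod_cast hm
  rw [div_div, ← rpow_add h]
  ring_nf

/-- `F` is antitone in `ε` at each `m ≥ 1`. [folklore] -/
theorem sigmaRpow_antitone {ε ε' : ℝ} (h : ε ≤ ε') {m : ℕ} (hm : 1 ≤ m) :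
    sigmaRpow ε' m ≤ sigmaRpow ε m := by
  rw [sigmaRpow_eq_div ε ε' hm]
  exact _root_.div_le_self (sigmaRpow_pos ε hm).le
    (one_le_rpow (by exact_mod_cast hm) (by linarith))

/-- (i) Smaller competitors only lose when the parameter decreases: `m ≤ N`,
`F_α(m) ≤ F_α(N)`, `ε ≤ α` give `F_ε(m) ≤ F_ε(N)`. [cite: AlaogluErdos1944, §3] -/
theorem sigmaRpow_le_of_le {ε α : ℝ} (hεα : ε ≤ α) {m N : ℕ} (hm : 1 ≤ m) (hmN : m ≤ N)
    (h : sigmaRpow α m ≤ sigmaRpow α N) : sigmaRpow ε m ≤ sigmaRpow ε N := by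
  have hN : 1 ≤ N := hm.trans hmN
  rw [sigmaRpow_eq_div α ε hm, sigmaRpow_eq_div α ε hN]
  have hd : ε - α ≤ 0 := by linarith
  have hmpos : (0 : ℝ) < m := by exact_mod_cast hm
  -- `N^{ε-α} ≤ m^{ε-α}` (non-positive exponent)
  have hpow : (N : ℝ) ^ (ε - α) ≤ (m : ℝ) ^ (ε - α) :=
    rpow_le_rpow_of_nonpos hmpos (by exact_mod_cast hmN) hd
  have hNpow : 0 < (N : ℝ) ^ (ε - α) := rpow_pos_of_pos (by exact_mod_cast hN) _
  calc sigmaRpow α m / (m : ℝ) ^ (ε - α) ≤ sigmaRpow α m / (N : ℝ) ^ (ε - α) :=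
        div_le_div_of_nonneg_left (sigmaRpow_pos α hm).le hNpow hpow
    _ ≤ sigmaRpow α N / (N : ℝ) ^ (ε - α) := div_le_div_of_nonneg_right h hNpow.le

/-- (ii) Parameters decrease along increasing maximisers: if `ε` is a parameter of `m`, `ε'` of
`m'`, and `m < m'`, then `ε' ≤ ε`. [cite: AlaogluErdos1944, §3] -/
theorem IsCAParameter.antitone {ε ε' : ℝ} {m m' : ℕ} (h : IsCAParameter ε m)
    (h' : IsCAParameter ε' m') (hm : 1 ≤ m) (hmm' : m < m') : ε' ≤ ε := by
  by_contra hle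
  have hlt : ε < ε' := not_le.1 hle
  have hm' : 1 ≤ m' := by omega
  have h1 : sigmaRpow ε m' ≤ sigmaRpow ε m := h m' hm'
  have h2 : sigmaRpow ε' m ≤ sigmaRpow ε' m' := h' m hm
  rw [sigmaRpow_eq_div ε ε' hm, sigmaRpow_eq_div ε ε' hm'] at h2
  have hd : 0 < ε' - ε := by linarith
  have hmpos : (0 : ℝ) < m := by exact_mod_cast hm
  have hpow : (m : ℝ) ^ (ε' - ε) < (m' : ℝ) ^ (ε' - ε) :=
    rpow_lt_rpow hmpos.le (by exact_mod_cast hmm') hd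
  have hmpow : 0 < (m : ℝ) ^ (ε' - ε) := rpow_pos_of_pos hmpos _
  have hFm : 0 < sigmaRpow ε m := sigmaRpow_pos ε hm
  have h3 : sigmaRpow ε m' / (m' : ℝ) ^ (ε' - ε) < sigmaRpow ε m / (m : ℝ) ^ (ε' - ε) :=
    calc sigmaRpow ε m' / (m' : ℝ) ^ (ε' - ε) ≤ sigmaRpow ε m / (m' : ℝ) ^ (ε' - ε) :=
          div_le_div_of_nonneg_right h1 (hmpow.trans hpow).le
      _ < sigmaRpow ε m / (m : ℝ) ^ (ε' - ε) := div_lt_div_of_pos_left hFm hmpow hpow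
  linarith

/-- Continuity of `ε ↦ F_ε(m)`. [folklore] -/
theorem continuous_sigmaRpow {m : ℕ} (hm : 1 ≤ m) : Continuous fun ε : ℝ => sigmaRpow ε m := by
  unfold sigmaRpow
  have hmpos : (0 : ℝ) < m := by exact_mod_cast hm
  have hc : Continuous fun ε : ℝ => (m : ℝ) ^ (1 + ε) :=
    (continuous_iff_continuousAt.2 fun _ => continuousAt_const_rpow hmpos.ne').comp
      (continuous_const.add continuous_id)
  exact continuous_const.div hc fun ε => (rpow_pos_of_pos hmpos _).ne'

/-! ### The least parameter of a colossally abundant number -/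

/-- Lower bound for parameters: if `ε` is a parameter of `N ≥ 1` and `q` is a prime not dividing
`N`, then `log(1 + 1/q)/log q ≤ ε` (compare `N` with `N q`). [cite: CaveneyNicolasSondow2012, §2] -/
theorem IsCAParameter.lower_bound {ε : ℝ} {N q : ℕ} (h : IsCAParameter ε N) (hN : 1 ≤ N)
    (hq : q.Prime) (hqN : ¬ q ∣ N) : Real.log (1 + (q : ℝ)⁻¹) / Real.log q ≤ ε := by
  have hcop : Coprime N q := (hq.coprime_iff_not_dvd.2 hqN).symm
  have hqpos : (0 : ℝ) < q := by exact_mod_cast hq.pos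
  have hq1 : (1 : ℝ) < q := by exact_mod_cast hq.one_lt
  have hNpos : (0 : ℝ) < N := by exact_mod_cast hN
  have hσq : σ 1 q = q + 1 := by
    have h := ArithmeticFunction.sigma_one_apply_prime_pow (i := 1) hq
    rw [pow_one] at h
    rw [h, Finset.sum_range_succ, Finset.sum_range_one, pow_zero, pow_one, add_comm]
  have hle := h (N * q) (by nlinarith [hq.pos])
  rw [ArithmeticFunction.isMultiplicative_sigma.map_mul_of_coprime hcop, hσq, Nat.cast_mul,
    Nat.cast_mul, mul_rpow hNpos.le hqpos.le, rpow_add hqpos, rpow_one] at hle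
  -- cancel `σ N / N^{1+ε} > 0`
  have hσN : (0 : ℝ) < σ 1 N := by exact_mod_cast one_le_sigma_one (by omega)
  have hNpow : 0 < (N : ℝ) ^ (1 + ε) := rpow_pos_of_pos hNpos _
  have hqε : 0 < (q : ℝ) ^ ε := rpow_pos_of_pos hqpos _
  have hkey : ((q + 1 : ℕ) : ℝ) ≤ q * (q : ℝ) ^ ε := by
    rw [div_le_div_iff₀ (by positivity) hNpow] at hle
    have : (σ 1 N : ℝ) * ((q + 1 : ℕ) : ℝ) * (N : ℝ) ^ (1 + ε) ≤
        (σ 1 N : ℝ) * ((N : ℝ) ^ (1 + ε) * (q * (q : ℝ) ^ ε)) := by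
      have h' := hle
      push_cast at h' ⊢
      nlinarith [h']
    have h2 : 0 < (σ 1 N : ℝ) * (N : ℝ) ^ (1 + ε) := mul_pos hσN hNpow
    nlinarith
  push_cast at hkey
  -- `1 + 1/q ≤ q^ε`, take logs
  have h1q : 1 + (q : ℝ)⁻¹ ≤ (q : ℝ) ^ ε := by
    rw [← div_le_iff₀' hqpos] at hkey
    calc 1 + (q : ℝ)⁻¹ = (q + 1) / q := by field_simp
      _ ≤ (q : ℝ) ^ ε := hkey
  have hlog := Real.log_le_log (by positivity) h1q
  rw [Real.log_rpow hqpos] at hlog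
  rw [div_le_iff₀ (Real.log_pos hq1)]
  linarith

/-- The parameters of `N` are closed under infima: if `T ⊆ {ε : ε is a parameter of N}` is nonempty
and bounded below then `inf T` is a parameter of `N` (each condition `F_ε(m) ≤ F_ε(N)` is closed
in `ε`). [folklore] -/
theorem isCAParameter_csInf {N : ℕ} (hN : 1 ≤ N) {T : Set ℝ} (hT : T.Nonempty) (hbdd : BddBelow T)
    (hpar : ∀ ε ∈ T, IsCAParameter ε N) : IsCAParameter (sInf T) N := by
  intro m hm
  by_contra hle
  have hlt : sigmaRpow (sInf T) N < sigmaRpow (sInf T) m := not_le.1 hle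
  -- strict inequality persists near `sInf T`
  have hev : ∀ᶠ ε in 𝓝 (sInf T), sigmaRpow ε N < sigmaRpow ε m :=
    ContinuousAt.eventually_lt (continuous_sigmaRpow hN).continuousAt
      (continuous_sigmaRpow hm).continuousAt hlt
  obtain ⟨η, hη, hball⟩ := Metric.eventually_nhds_iff.1 hev
  obtain ⟨ε, hεT, hεlt⟩ := exists_lt_of_csInf_lt hT (lt_add_of_pos_right (sInf T) hη)
  have hεge : sInf T ≤ ε := csInf_le hbdd hεT
  have hdist : Dist.dist ε (sInf T) < η := by
    rw [Real.dist_eq, abs_of_nonneg (by linarith)]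
    linarith
  have h1 := hball hdist
  have h2 := hpar ε hεT m hm
  exact absurd h2 (not_le.2 h1)

/-- **The key structural step** (Robin 1984, p. 190; Alaoglu–Erdős 1944, §3): every colossally
abundant `N` has a parameter `α > 0` (its least parameter) that is also a parameter of some
`m⋆ > N` — the maximum of `σ(m)/m^{1+α}` is attained at `N` and at a larger number.
[cite: Robin1984, p. 190 (structure of CA numbers)] -/
theorem ColossallyAbundant.exists_common_parameter_gt {N : ℕ} (hCA : ColossallyAbundant N) :
    ∃ α : ℝ, 0 < α ∧ IsCAParameter α N ∧ ∃ m : ℕ, N < m ∧ IsCAParameter α m := by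
  classical
  obtain ⟨hN2, ε₀, hε₀, hpar₀⟩ := hCA
  have hN : 1 ≤ N := by omega
  -- the set of positive parameters, its positive lower bound, its infimum `α`
  set T : Set ℝ := {ε | 0 < ε ∧ IsCAParameter ε N} with hTdef
  have hT : T.Nonempty := ⟨ε₀, hε₀, hpar₀⟩
  obtain ⟨q, hqge, hq⟩ := Nat.exists_infinite_primes (N + 1)
  have hqN : ¬ q ∣ N := fun h => absurd (Nat.le_of_dvd hN h) (by omega)
  set δ : ℝ := Real.log (1 + (q : ℝ)⁻¹) / Real.log q with hδdef
  have hδpos : 0 < δ := by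
    have hqpos : (0 : ℝ) < q := by exact_mod_cast hq.pos
    have hq1 : (1 : ℝ) < q := by exact_mod_cast hq.one_lt
    have : (1 : ℝ) < 1 + (q : ℝ)⁻¹ := by simp [hqpos]
    exact _root_.div_pos (Real.log_pos this) (Real.log_pos hq1)
  have hδT : ∀ ε ∈ T, δ ≤ ε := fun ε hε => hε.2.lower_bound hN hq hqN
  have hbdd : BddBelow T := ⟨δ, hδT⟩
  set α : ℝ := sInf T with hαdef
  have hαδ : δ ≤ α := le_csInf hT hδT
  have hα : 0 < α := hδpos.trans_le hαδ
  have hαpar : IsCAParameter α N := isCAParameter_csInf hN hT hbdd fun ε hε => hε.2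
  refine ⟨α, hα, hαpar, ?_⟩
  -- suppose no larger co-maximiser
  by_contra hnone
  have hstrict : ∀ m : ℕ, N < m → sigmaRpow α m < sigmaRpow α N := by
    intro m hm
    have hle : sigmaRpow α m ≤ sigmaRpow α N := hαpar m (by omega)
    rcases hle.lt_or_eq with h | h
    · exact h
    · exfalso
      refine hnone ⟨m, hm, fun k hk => ?_⟩
      rw [show (σ 1 m : ℝ) / (m : ℝ) ^ (1 + α) = sigmaRpow α m from rfl, h]
      exact hαpar k hk
  -- decay threshold at `α/2`
  obtain ⟨M₁, hM₁⟩ := eventually_sigma_div_rpow_lt_one (half_pos hα)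
  -- near `α`, the finitely many `m ∈ (N, M₁]` keep the strict inequality
  set S : Finset ℕ := Finset.Ioc N M₁ with hSdef
  have hevS : ∀ᶠ ε in 𝓝 α, ∀ m ∈ S, sigmaRpow ε m < sigmaRpow ε N := by
    rw [Finset.eventually_all]
    intro m hm
    rw [hSdef, Finset.mem_Ioc] at hm
    exact ContinuousAt.eventually_lt (continuous_sigmaRpow (by omega)).continuousAt
      (continuous_sigmaRpow hN).continuousAt (hstrict m hm.1)
  have hevhalf : ∀ᶠ ε in 𝓝 α, α / 2 < ε := lt_mem_nhds (by linarith)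
  have hev : ∀ᶠ ε in 𝓝[<] α, (∀ m ∈ S, sigmaRpow ε m < sigmaRpow ε N) ∧ α / 2 < ε ∧ ε < α := by
    have h1 : ∀ᶠ ε in 𝓝[<] α, (∀ m ∈ S, sigmaRpow ε m < sigmaRpow ε N) ∧ α / 2 < ε :=
      (hevS.and hevhalf).filter_mono nhdsWithin_le_nhds
    have h2 : ∀ᶠ ε in 𝓝[<] α, ε < α := self_mem_nhdsWithin
    exact (h1.and h2).mono fun ε h => ⟨h.1.1, h.1.2, h.2⟩
  obtain ⟨ε, hεS, hεhalf, hεα⟩ := hev.exists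
  -- `ε` is a parameter of `N`
  have hεpar : IsCAParameter ε N := by
    intro m hm
    change sigmaRpow ε m ≤ sigmaRpow ε N
    by_cases hmN : m ≤ N
    · exact sigmaRpow_le_of_le hεα.le hm hmN (hαpar m hm)
    by_cases hmM : m ≤ M₁
    · exact (hεS m (by rw [hSdef, Finset.mem_Ioc]; omega)).le
    · -- `m > M₁`: `F_ε(m) ≤ F_{α/2}(m) < 1 = F_α(1) ≤ F_α(N) ≤ F_ε(N)`
      have h1 : sigmaRpow ε m ≤ sigmaRpow (α / 2) m := sigmaRpow_antitone hεhalf.le hm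
      have h2 : sigmaRpow (α / 2) m < 1 := hM₁ m (by omega)
      have h3 : (1 : ℝ) ≤ sigmaRpow α N := by
        have := hαpar 1 le_rfl
        rwa [show (σ 1 1 : ℝ) / ((1 : ℕ) : ℝ) ^ (1 + α) = sigmaRpow α 1 from rfl,
          sigmaRpow_one] at this
      have h4 : sigmaRpow α N ≤ sigmaRpow ε N := sigmaRpow_antitone hεα.le hN
      linarith
  -- contradiction with `α = inf T`
  have hεT : ε ∈ T := ⟨by linarith, hεpar⟩
  have : α ≤ ε := csInf_le hbdd hεT
  linarith

/-- **Robin 1984, p. 190 (Briggs 2006, Thm. 2.1; Caveney–Nicolas–Sondow 2012, §2): consecutive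
colossally abundant numbers have a common parameter** — discharge of the named fact
`Nat.colossallyAbundant_consecutive_common_parameter` (`RobinCriterion.lean`).
[cite: Robin1984, p. 190 (structure of CA numbers)] -/
theorem colossallyAbundant_consecutive_common_parameter_holds :
    colossallyAbundant_consecutive_common_parameter := by
  intro N N' hN hN' hlt hnone
  obtain ⟨α, hα, hαN, m, hNm, hαm⟩ := hN.exists_common_parameter_gt
  have hN1 : 1 ≤ N := hN.one_le
  have hmCA : ColossallyAbundant m := ⟨by have := hN.two_le; omega, α, hα, hαm⟩
  have hN'm : N' ≤ m := by
    by_contra h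
    exact hnone m hNm (by omega) hmCA
  rcases hN'm.lt_or_eq with h | h
  · -- `N < N' < m`: squeeze the parameter of `N'`
    obtain ⟨-, ε', hε', hpar'⟩ := hN'
    have h1 : ε' ≤ α := hαN.antitone hpar' hN1 hlt
    have h2 : α ≤ ε' := IsCAParameter.antitone hpar' hαm (by omega) h
    have heq : ε' = α := le_antisymm h1 h2
    exact ⟨α, hα, hαN, heq ▸ hpar'⟩
  · subst h
    exact ⟨α, hα, hαN, hαm⟩

end Nat

namespace Literature.NumberTheory.LFunctions

/-- **Robin 1984, §3 Prop. 1 holds outright**: interpolation of Robin's inequality between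
consecutive colossally abundant numbers (`Robin1984_prop1_of_common_parameter` fed with the
structure theorem). [cite: Robin1984, §3 Prop. 1 (p. 192)] -/
theorem Robin1984_prop1_holds : Robin1984_prop1 :=
  Robin1984_prop1_of_common_parameter Nat.colossallyAbundant_consecutive_common_parameter_holds

/-- Robin's criterion from the three remaining named facts (the analytic colossally abundant case
of Thm. 1 under RH, the numerical range, and the oscillation theorem): the structural and
tabular leaves of the DAG are now theorems (`…_common_parameter_holds`,
`Nat.colossallyAbundant_55440_holds`, `Nat.setOf_colossallyAbundant_infinite_holds`).
[cite: Robin1984, Thm. 1 and §4 Prop. 1] -/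
theorem robin_iff_of_parts₃ (hCA : Robin1984_thm1_colossallyAbundant)
    (hB : Briggs2006_robinInequality_le) (h₂ : Robin1984_sigma_oscillation) : robin_iff :=
  robin_iff_of_parts hCA Nat.colossallyAbundant_consecutive_common_parameter_holds hB
    Nat.colossallyAbundant_55440_holds Nat.setOf_colossallyAbundant_infinite_holds h₂

end Literature.NumberTheory.LFunctions

end
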